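/-
PORT (pub-hodgecm2, COR-CM cell) of the stage-1 package file `HodgeCMPerL/HodgeCM/Proofs/Prop22/Algebraic.lean`
(pub-hodgecm HOME/lean, bytes of record md5 d0621a315e9e, 491 lines). Declarations VERBATIM; edits: imports rewritten to tree
modules, namespace token `HodgeCM` ↦ `Summit.HodgeConjecture.CorCM`, package `conjRingHomK` ↦ tree `Literature.NumberTheory.Automorphic.cmConjRingHom`
(definitionally equal bodies), linter fixes. Generator: pub-hodgecm2-p1 `work/port/build_kit.py`.
-/
/-
Copyright: pub-hodgecm formalisation cell (harness21, 2026). New file (not vendored).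
-/
import Mathlib.LinearAlgebra.Charpoly.Basic
import Summits.HodgeConjecture.CorCM.Proofs.Prop22.Eigen

/-!
# rfwf Prop 2.2, Steps E–F: from one detected Weil class to `W_K(P) ⊆ Alg²(P)`

Let `y = y_σ` be a Weil generator of eigencharacter `σ` and `z ∈ Alg^{d-2}(P)` a rational algebraic class
with `∫_P y ∪ z ≠ 0` (this is what the Gysin formula M26 produces from the period hypothesis of the
surface criterion). We show `W_K(P) ⊆ Alg²(P)`:
* `b ∈ 𝓞_K` separating (S5), `T = ` the action of `b` on `H⁴(P, ℚ)` (M24, M18), `m = minpoly_ℚ(b⁴)`;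
  `W_K(P) = ` the part of `H⁴(P, ℚ)` where `T` acts through `K = ℚ(b⁴)`: `ker m(T)ⁿ ⊆ W_K(P) ⊆ ker m(T)`
  (eigen-bookkeeping of `Summit.HodgeConjecture.CorCM.Proofs.Prop22.Eigen`);
* the algebraic self-duality `D` of M28 turns `z` into an ALGEBRAIC class `x₁ = D z ∈ H⁴(P, ℚ)`, and its
  projection `x = π(x₁)` to `ker m(T)ⁿ` along `ker r(T)` (`m·χ_T = mⁿ r`, Bézout) is algebraic (M7) and
  NONZERO: for the sesquilinear form `G(y, x') = ∫ y ∪ D⁻¹x'` one has `G(b̄^* y, x') = G(y, T x')`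
  (M27 + M28(ii)), `G(y_σ, x₁) = ∫ y_σ ∪ z ≠ 0`, and `G(y_σ, (s mⁿ)(T) x₁) = (s mⁿ)(σ̄(b⁴)) G(y_σ, x₁) = 0`;
* `W_K(P)` is `T`-stable of `ℚ`-dimension `[K:ℚ] = deg m` (M13) and contains the `T`-cyclic span of `x`,
  which has dimension `deg m` (irreducibility) and consists of algebraic classes. Hence `W_K(P) ⊆ Alg²(P)`.
-/

noncomputable section

open scoped TensorProduct NumberField IntermediateField

namespace Summit.HodgeConjecture.CorCM

open Literature.AlgebraicGeometry.Motives
open Literature.AlgebraicGeometry.Motives.HodgeStructure (EndAction conj ofRat conj_baseChange conj_smul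
  conj_conj conj_tmul)
open Literature.NumberTheory.Automorphic (cmConjRingHom embedding_cmConjRingHom)
open NumberField (RingOfIntegers)
open NumberField.ComplexEmbedding (conjugate)
open Polynomial

namespace Universe

variable {U : Universe}

/-! ### Complexified cup with a rational class; Gysin and adjunction over `ℂ` -/

/-- `y ↦ y ∪ z` on complexified cohomology, for a fixed RATIONAL class `z`. -/
def cupRC (X : U.Var) (i j : ℕ) (z : U.Coh X j) : U.CohC X i →ₗ[ℂ] U.CohC X (i + j) :=
  ((U.cup X i j).flip z).baseChange ℂ

/-- The right-complexified cup `cupRC` on a pure tensor: `cupRC z (c ⊗ y) = c ⊗ (y ∪ z)`. -/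
@[simp] theorem cupRC_tmul (X : U.Var) (i j : ℕ) (z : U.Coh X j) (c : ℂ) (y : U.Coh X i) :
    U.cupRC X i j z (c ⊗ₜ y) = c ⊗ₜ U.cup X i j y z := rfl

/-- M26 complexified in `y`. -/
theorem gysinC (M : U.ModelAxioms) (S X : U.Var) (f : U.Mor S X) (hS : U.dim S = 2) :
    ∃ c ∈ U.alg X (U.dim X - 2), ∀ y : U.CohC X 4,
      U.trC S 4 (U.pullC f 4 y) = U.trC X (4 + 2 * (U.dim X - 2)) (U.cupRC X 4 _ c y) := by
  obtain ⟨c, hc, h⟩ := M.gysin_surface S X f hS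
  refine ⟨c, hc, fun y => ?_⟩
  induction y using TensorProduct.induction_on with
  | zero => simp
  | add a a' ha ha' => simp only [map_add, ha, ha']
  | tmul w y => simp [h y]

section detect

variable (K : CMField) (Φ : Fin 4 → CMType K)

/-- `B_ℂ(y, z) = ∫_P y ∪ z` (`y ∈ H⁴(P, ℂ)`, `z ∈ H^{2d-4}(P, ℚ)`). -/
def Bc (y : U.CohC (U.prod4 K Φ) 4) (z : U.Coh (U.prod4 K Φ) (2 * (U.dim (U.prod4 K Φ) - 2))) : ℂ :=
  U.trC _ (4 + 2 * (U.dim (U.prod4 K Φ) - 2)) (U.cupRC _ 4 _ z y)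

variable {K Φ}

/-- The pairing `Bc` (complexified cup-and-trace on `H⁴(P)`) is additive in the left variable. -/
theorem Bc_add_left (y y' : U.CohC (U.prod4 K Φ) 4) (z) : U.Bc K Φ (y + y') z = U.Bc K Φ y z + U.Bc K Φ y' z := by
  simp [Bc]

/-- `Bc` is `ℂ`-homogeneous in the left variable. -/
theorem Bc_smul_left (c : ℂ) (y : U.CohC (U.prod4 K Φ) 4) (z) : U.Bc K Φ (c • y) z = c * U.Bc K Φ y z := by
  simp [Bc]

/-- `Bc` is additive in the right (rational) variable. -/
theorem Bc_add_right (y : U.CohC (U.prod4 K Φ) 4) (z z') : U.Bc K Φ y (z + z') = U.Bc K Φ y z + U.Bc K Φ y z' := by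
  simp only [Bc]
  induction y using TensorProduct.induction_on with
  | zero => simp
  | add a a' ha ha' => simp only [map_add, ha, ha']; ring
  | tmul w y => simp [add_smul]

/-- `Bc` is `ℚ`-homogeneous in the right variable. -/
theorem Bc_smul_right (y : U.CohC (U.prod4 K Φ) 4) (q : ℚ) (z) : U.Bc K Φ y (q • z) = (q : ℂ) * U.Bc K Φ y z := by
  simp only [Bc]
  induction y using TensorProduct.induction_on with
  | zero => simp
  | add a a' ha ha' => simp only [map_add, ha, ha']; ring
  | tmul w y =>
    rw [cupRC_tmul, cupRC_tmul, LinearMap.map_smul, TensorProduct.tmul_smul, TensorProduct.smul_tmul',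
      trC_tmul, trC_tmul]
    simp only [Rat.smul_def]
    ring

/-- **Adjunction** (M27 + M2, complexified): `B(a^* y, a^* z) = N(a)⁴ B(y, z)`. -/
theorem Bc_pull_pull (M : U.ModelAxioms) {a : K} {Ma : U.Mor (U.prod4 K Φ) (U.prod4 K Φ)} (h : U.IsDiagAct K Φ a Ma)
    (y : U.CohC (U.prod4 K Φ) 4) (z) :
    U.Bc K Φ (U.pullC Ma 4 y) (U.pull Ma _ z) = ((Algebra.norm ℚ a) ^ 4 : ℚ) * U.Bc K Φ y z := by
  have hdeg := M.deg_diag K Φ a Ma h (4 + 2 * (U.dim (U.prod4 K Φ) - 2))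
  simp only [Bc]
  induction y using TensorProduct.induction_on with
  | zero => simp
  | add y y' hy hy' => simp only [map_add, hy, hy']; ring
  | tmul w y =>
    rw [pullC_tmul, cupRC_tmul, cupRC_tmul, ← M.pull_cup, trC_tmul, trC_tmul]
    have := LinearMap.congr_fun hdeg (U.cup _ 4 _ y z)
    simp only [LinearMap.comp_apply, LinearMap.smul_apply] at this
    rw [this]
    simp only [Rat.smul_def, smul_eq_mul]
    push_cast; ring

/-! ### Polynomials in the diagonal action -/

/-- Base change to `ℂ` commutes with polynomial evaluation at an endomorphism: `(q(T))_ℂ = q(T_ℂ)`. -/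
theorem baseChange_aeval {V : Type*} [AddCommGroup V] [Module ℚ V] (T : V →ₗ[ℚ] V) (q : ℚ[X]) :
    (aeval T q).baseChange ℂ = aeval (T.baseChange ℂ) q := by
  induction q using Polynomial.induction_on' with
  | add p q hp hq => simp only [map_add, LinearMap.baseChange_add, hp, hq]
  | monomial n a =>
    simp only [aeval_monomial, Algebra.algebraMap_eq_smul_one, smul_mul_assoc, one_mul,
      LinearMap.baseChange_smul, LinearMap.baseChange_pow]

omit U in
/-- a `T`-stable subspace is stable under polynomials in `T` -/
theorem aeval_apply_mem {R V : Type*} [CommRing R] [AddCommGroup V] [Module R V] (N : Submodule R V)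
    (T : V →ₗ[R] V) (hT : ∀ v ∈ N, T v ∈ N) (q : R[X]) : ∀ v ∈ N, aeval T q v ∈ N := by
  induction q using Polynomial.induction_on' with
  | add p q hp hq =>
    intro v hv
    simp only [map_add, LinearMap.add_apply]
    exact add_mem (hp v hv) (hq v hv)
  | monomial n a =>
    intro v hv
    simp only [aeval_monomial, Algebra.algebraMap_eq_smul_one, smul_mul_assoc, one_mul, LinearMap.smul_apply]
    refine Submodule.smul_mem _ _ ?_
    induction n generalizing v with
    | zero => simpa
    | succ n ih => rw [pow_succ', Module.End.mul_apply]; exact hT _ (ih v hv)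

omit U in
/-- `p(T) g = p(μ) g` for an eigenvector `g` (possibly zero), `p` over the scalar ring. -/
theorem aeval_apply_of_eigen' {R V : Type*} [CommRing R] [AddCommGroup V] [Module R V] (T : V →ₗ[R] V)
    {μ : R} {g : V} (hg : T g = μ • g) (p : R[X]) : aeval T p g = (p.eval μ) • g := by
  induction p using Polynomial.induction_on' with
  | add p q hp hq => simp only [map_add, LinearMap.add_apply, hp, hq, eval_add, add_smul]
  | monomial n a =>
    simp only [aeval_monomial, Algebra.algebraMap_eq_smul_one, smul_mul_assoc, one_mul, LinearMap.smul_apply,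
      eval_monomial]
    have : (T ^ n) g = μ ^ n • g := by
      induction n with
      | zero => simp
      | succ n ih => rw [pow_succ', Module.End.mul_apply, ih, map_smul, hg, smul_smul, ← pow_succ]
    rw [this, smul_smul]

omit U in
/-- **LA1 (Lagrange/Bézout).** If `T` has a spanning family of eigenvectors `sᵢ` (eigenvalues `evᵢ`), then
`ker q(T)` lies in the span of those `sᵢ` with `q(evᵢ) = 0`. -/
theorem mem_span_of_aeval_eq_zero {W : Type*} [AddCommGroup W] [Module ℚ W] {ι : Type*} [Fintype ι]
    (T : ℂ ⊗[ℚ] W →ₗ[ℂ] ℂ ⊗[ℚ] W) (s : ι → ℂ ⊗[ℚ] W) (ev : ι → ℂ) (hs : ∀ i, T (s i) = ev i • s i)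
    (hsp : Submodule.span ℂ (Set.range s) = ⊤) (q : ℚ[X]) {w : ℂ ⊗[ℚ] W} (hw : aeval T q w = 0) :
    w ∈ Submodule.span ℂ (s '' {i | aeval (ev i) q = 0}) := by
  classical
  set S := Submodule.span ℂ (s '' {i | aeval (ev i) q = 0})
  let bad : Finset ℂ := (Finset.univ.image ev).filter fun z => aeval z q ≠ 0
  let P : ℂ[X] := ∏ z ∈ bad, (X - C z)
  have hcop : IsCoprime P (q.map (algebraMap ℚ ℂ)) := by
    refine IsCoprime.prod_left fun z hz => ?_
    rw [Finset.mem_filter] at hz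
    refine (Polynomial.irreducible_X_sub_C z).coprime_iff_not_dvd.mpr fun hd => hz.2 ?_
    rw [Polynomial.dvd_iff_isRoot, Polynomial.IsRoot.def, Polynomial.eval_map_algebraMap] at hd
    exact hd
  obtain ⟨A, B, hAB⟩ := hcop
  have hS_T : ∀ v ∈ S, T v ∈ S := by
    intro v hv
    induction hv using Submodule.span_induction with
    | mem v hv =>
      obtain ⟨i, hi, rfl⟩ := hv
      rw [hs i]; exact S.smul_mem _ (Submodule.subset_span ⟨i, hi, rfl⟩)
    | zero => simp
    | add v v' _ _ h h' => simpa only [map_add] using add_mem h h'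
    | smul r v _ h => simpa only [map_smul] using S.smul_mem r h
  have hPw : aeval T P w ∈ S := by
    have hw' : w ∈ Submodule.span ℂ (Set.range s) := by rw [hsp]; trivial
    clear hw
    induction hw' using Submodule.span_induction with
    | mem v hv =>
      obtain ⟨i, rfl⟩ := hv
      rw [aeval_apply_of_eigen' T (hs i)]
      by_cases hi : aeval (ev i) q = 0
      · exact S.smul_mem _ (Submodule.subset_span ⟨i, hi, rfl⟩)
      · have : P.eval (ev i) = 0 := by
          rw [Polynomial.eval_prod]
          refine Finset.prod_eq_zero (i := ev i) ?_ (by simp)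
          simp [bad, hi]
        rw [this, zero_smul]; exact S.zero_mem
    | zero => simp
    | add v v' _ _ h h' => simpa only [map_add] using add_mem h h'
    | smul r v _ h => simpa only [map_smul] using S.smul_mem r h
  have : w = aeval T A (aeval T P w) := by
    have h1 := congrArg (fun r => aeval T r w) hAB
    simp only [map_add, map_mul, map_one, LinearMap.add_apply, Module.End.mul_apply, Module.End.one_apply,
      Polynomial.aeval_map_algebraMap, hw, map_zero, add_zero] at h1
    exact h1.symm
  rw [this]
  exact aeval_apply_mem S T hS_T A _ hPw

/-- Pull-back along an endomorphism of the corner product preserves codimension-2 algebraic classes (`Fact_pull_alg`). -/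
theorem pull_mem_alg2 (M : U.ModelAxioms) {N : U.Mor (U.prod4 K Φ) (U.prod4 K Φ)} :
    ∀ v ∈ U.alg (U.prod4 K Φ) 2, U.pull N 4 v ∈ U.alg (U.prod4 K Φ) 2 := by
  intro v hv
  exact M.pull_alg _ _ N 2 ⟨v, hv, rfl⟩

/-! ### CLAIM B and stability: `W ⊆ ker m(T)`, `T W ⊆ W` -/

/-- Membership in the Weil line: the complexification lies in the span of the Weil generators (definitional). -/
theorem mem_weilLine_iff {w : U.Coh (U.prod4 K Φ) 4} :
    w ∈ U.weilLine K Φ ↔ (ofRat w : U.CohC _ 4) ∈ Submodule.span ℂ (U.weilGenerators K Φ) := Iff.rfl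

/-- polynomials in a diagonal action act on a Weil generator of character `σ` by the scalar `p(σ(b)⁴)` -/
theorem aeval_pullC_weilGen (M : U.ModelAxioms) {b : K} {Mb : U.Mor (U.prod4 K Φ) (U.prod4 K Φ)}
    (h : U.IsDiagAct K Φ b Mb) {σ : K →+* ℂ} {y : (i : Fin 4) → U.CohC (U.cmAV K (Φ i)) 1}
    (hy : ∀ i, y i ∈ U.eigenLine K (Φ i) σ) (p : ℚ[X]) :
    aeval (U.pullC Mb 4) p (U.weilGen K Φ y) = aeval (σ b ^ 4) p • U.weilGen K Φ y :=
  aeval_apply_of_eigen _ (pullC_weilGen_eigen M h hy) p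

/-- the span of the Weil generators is stable under polynomials in a diagonal action, which act on it
through their values at the `σ(b)⁴` -/
theorem aeval_pullC_mem_span (M : U.ModelAxioms) {b : K} {Mb : U.Mor (U.prod4 K Φ) (U.prod4 K Φ)}
    (h : U.IsDiagAct K Φ b Mb) (p : ℚ[X]) {v : U.CohC (U.prod4 K Φ) 4}
    (hv : v ∈ Submodule.span ℂ (U.weilGenerators K Φ)) :
    aeval (U.pullC Mb 4) p v ∈ Submodule.span ℂ {x | ∃ (σ : K →+* ℂ) (y : (i : Fin 4) → U.CohC (U.cmAV K (Φ i)) 1),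
      (∀ i, y i ∈ U.eigenLine K (Φ i) σ) ∧ x = aeval (σ b ^ 4) p • U.weilGen K Φ y} := by
  induction hv using Submodule.span_induction with
  | mem x hx =>
    obtain ⟨σ, y, hy, rfl⟩ := hx
    refine Submodule.subset_span ⟨σ, y, hy, ?_⟩
    exact aeval_pullC_weilGen M h hy p
  | zero => simp
  | add x x' _ _ hx hx' => simpa only [map_add] using add_mem hx hx'
  | smul c x _ hx => simpa only [map_smul] using Submodule.smul_mem _ c hx

/-- The Weil line is stable under pull-back along a diagonal `K`-action `Mb`. -/
theorem weilLine_stable (M : U.ModelAxioms) {b : K} {Mb : U.Mor (U.prod4 K Φ) (U.prod4 K Φ)} (h : U.IsDiagAct K Φ b Mb) :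
    ∀ w ∈ U.weilLine K Φ, U.pull Mb 4 w ∈ U.weilLine K Φ := by
  intro w hw
  rw [mem_weilLine_iff] at hw ⊢
  have := aeval_pullC_mem_span M h X hw
  simp only [aeval_X] at this
  refine Submodule.span_le.mpr ?_ this
  rintro _ ⟨σ, y, hy, rfl⟩
  exact Submodule.smul_mem _ _ (Submodule.subset_span ⟨σ, y, hy, rfl⟩)

/-- On the Weil line, pull-back along the diagonal action of `b` is killed by the minimal polynomial of `b⁴`. -/
theorem weilLine_killed (M : U.ModelAxioms) {b : K} {Mb : U.Mor (U.prod4 K Φ) (U.prod4 K Φ)} (h : U.IsDiagAct K Φ b Mb) :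
    ∀ w ∈ U.weilLine K Φ, aeval (U.pull Mb 4) (minpoly ℚ (b ^ 4)) w = 0 := by
  intro w hw
  rw [mem_weilLine_iff] at hw
  apply ofRat_injective
  rw [map_zero, ofRat_baseChange, baseChange_aeval]
  have := aeval_pullC_mem_span M h (minpoly ℚ (b ^ 4)) hw
  have h0 : ∀ σ : K →+* ℂ, aeval (σ b ^ 4) (minpoly ℚ (b ^ 4)) = 0 := fun σ => by
    rw [← map_pow, show (σ (b ^ 4) : ℂ) = σ.toRatAlgHom (b ^ 4) from rfl, aeval_algHom_apply, minpoly.aeval,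
      map_zero]
  rw [Submodule.span_eq_bot.mpr, Submodule.mem_bot] at this
  · exact this
  rintro _ ⟨σ, y, hy, rfl⟩
  rw [h0 σ, zero_smul]

/-! ### CLAIM A: `ker m(T)ⁿ ⊆ W` (the eigen-bookkeeping) -/

/-- For a separating integer `b`, the kernel of `(minpoly (b⁴))(Mb^*)^n` on `H⁴(P, ℚ)` is contained in the Weil line. -/
theorem ker_le_weilLine (M : U.ModelAxioms) {b : 𝓞 K}
    (hsep : ∀ (τ : Fin 4 → (K →+* ℂ)) (σ : K →+* ℂ), (∏ j, τ j (b : K)) = (σ (b : K)) ^ 4 → ∀ j, τ j = σ)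
    {Mb : U.Mor (U.prod4 K Φ) (U.prod4 K Φ)} (h : U.IsDiagAct K Φ (b : K) Mb) (n : ℕ) :
    ∀ w, aeval (U.pull Mb 4) ((minpoly ℚ ((b : K) ^ 4)) ^ n) w = 0 → w ∈ U.weilLine K Φ := by
  intro w hw
  have hb : Function.Injective fun τ : K →+* ℂ => τ (b : K) := injective_eval_of_separating hsep
  have hx := fun i => U.exists_eigenbasis M K (Φ i) (b : K) hb
  choose x hx hx0 hxsp using hx
  rw [mem_weilLine_iff]
  have hwC : aeval (U.pullC Mb 4) ((minpoly ℚ ((b : K) ^ 4)) ^ n) (ofRat w) = 0 := by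
    have := congrArg ofRat hw
    rw [map_zero, ofRat_baseChange, baseChange_aeval] at this
    exact this
  have key := mem_span_of_aeval_eq_zero (U.pullC Mb 4) (U.quadU x) (fun p => ∏ j, (p j).2 (b : K))
    (U.pullC_quadU M h x hx) (U.span_quadU_eq_top M x hxsp) _ hwC
  refine (Submodule.span_le.mpr ?_) key
  rintro _ ⟨p, hp, rfl⟩
  simp only [Set.mem_setOf_eq, map_pow, pow_eq_zero_iff', ne_eq] at hp
  obtain ⟨hp, -⟩ := hp
  have hroot : (∏ j, (p j).2 (b : K)) ∈ Set.range fun φ : K →+* ℂ => φ ((b : K) ^ 4) := by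
    rw [NumberField.Embeddings.range_eval_eq_rootSet_minpoly, Polynomial.mem_rootSet]
    exact ⟨minpoly.ne_zero (Algebra.IsIntegral.isIntegral _), hp⟩
  obtain ⟨τ, hτ⟩ := hroot
  have hτ : τ ((b : K) ^ 4) = ∏ j, (p j).2 (b : K) := hτ
  have hall := hsep (fun j => (p j).2) τ (by rw [← hτ, map_pow])
  have hpj : ∀ j, p j = ((p j).1, τ) := fun j => Prod.ext rfl (hall j)
  have hmem : U.quadU x p ∈ ℂ ∙ U.weilGen K Φ (fun i => x i τ) := by
    unfold Universe.quadU
    refine U.quadC_mem_span_weilGen M x τ (fun j => U.uvec x (p j)) fun j => ?_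
    rw [hpj j]
    exact Submodule.subset_span (Set.mem_range.mpr ⟨(p j).1, rfl⟩)
  exact (Submodule.span_singleton_le_iff_mem _ _).mpr (Submodule.subset_span (weilGen_mem fun i => hx i τ)) hmem

/-! ### `deg m = [K:ℚ]` -/

/-- For a separating `b`, `b⁴` generates `K`: `deg minpoly_ℚ(b⁴) = [K:ℚ]`. -/
theorem natDegree_minpoly_pow_four {b : 𝓞 K}
    (hsep : ∀ (τ : Fin 4 → (K →+* ℂ)) (σ : K →+* ℂ), (∏ j, τ j (b : K)) = (σ (b : K)) ^ 4 → ∀ j, τ j = σ) :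
    (minpoly ℚ ((b : K) ^ 4)).natDegree = Module.finrank ℚ K := by
  have hprim : ℚ⟮((b : K) ^ 4)⟯ = ⊤ := by
    rw [Field.primitive_element_iff_algHom_eq_of_eval' ℚ ℂ (fun x => IsAlgClosed.splits _)]
    intro φ ψ hφψ
    apply AlgHom.coe_ringHom_injective
    refine hsep (fun _ => (φ : K →+* ℂ)) (ψ : K →+* ℂ) ?_ 0
    simp only [Finset.prod_const, Finset.card_univ, Fintype.card_fin]
    have h4 : φ (b : K) ^ 4 = ψ (b : K) ^ 4 := by simpa only [map_pow] using hφψ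
    exact h4
  have h := IntermediateField.adjoin.finrank (Algebra.IsIntegral.isIntegral (R := ℚ) ((b : K) ^ 4))
  rw [hprim, IntermediateField.finrank_top'] at h
  exact h.symm

/-! ### S9. The cyclic-span dimension argument -/


end detect
end Universe
end Summit.HodgeConjecture.CorCM
end
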